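import Mathlib
import HarnessLib
import HarnessLib.Audit
import Summits.Parity.Statement
import Literature.Barriers.Parity.SiegelZeroDichotomy

/-!
Route: ExceptionalWindows

DORMANT since 2026-09-04T15:05:02Z (reconciler: no traction for 5 d (last activity statement-checked at 2026-08-30T13:52:06Z); parked, not closed — `ledger route dormant route-Parity-ExceptionalWindows --off` to reactivate) — unstaffed, not closed; items shared with open routes are served there. `ledger route dormant <id> --off` reactivates.

# Route ExceptionalWindows — GHL iff bounded Siegel quality and signed HL at Siegel-free scales

It suffices to show X = Q ∧ U♮ ∧ L♮: (Q) Siegel zeros have bounded quality at large conductors —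
verbatim
`¬ Literature.Barriers.Parity.UnboundedSiegelZeros`; (U♮) the UPPER one-sided generalized
Hardy–Littlewood
bound holds at every large scale N that lies outside every window q ≤ N ≤ q^η of a Siegel zero of
quality
η ≥ η₀ at a conductor q ≥ q₀ (for every threshold η₀, q₀); (L♮) the LOWER one-sided bound at the
same
Siegel-free scales. Lens «minimal counterexample» (decomp-parity lens-4): the only
counterexample-producing
mechanism on file is an exceptional character (Matomäki–Merikoski Thm 1.3: factor 2 at h = 2q, N =
q^10),
and it acts inside its window; U♮ ∧ L♮ = «every counterexample lies in an exceptional window», Q =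
«the
windows are eventually empty». No card realised (decomposition cell D-0178).
Lean: `(¬ Literature.Barriers.Parity.UnboundedSiegelZeros) ∧
Summit.Parity.GeneralizedHardyLittlewood.Theses.ExceptionalWindows.SiegelFreeNoExcess ∧
Summit.Parity.GeneralizedHardyLittlewood.Theses.ExceptionalWindows.SiegelFreeNoDeficit`

## Assembly
Pure logic (draft theorem `closes`, 20 lines): Q supplies (η₀, q₀) beyond which no Siegel zero
exists, so every
large N is outside every (η₀, q₀)-window; U♮ and L♮ at those parameters give the two one-sided
bounds, and
|a − b| ≤ εN^d is their conjunction (N₀ := max). Conversely GHL ⟹ each piece (U♮, L♮ trivially; Q by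
the tree's
MM2023 bridge), so the node is an exact AND.

Rationale: WHY THIS LINE. Heath-Brown 1983, Tao–Teräväinen 2021 (arXiv:2109.06291) and Matomäki–Merikoski 2023
(arXiv:2112.11412) show that an
exceptional zero of quality η → ∞ DECIDES prime-pair correlations at scales X = q^V: the fixed-shift
asymptotic holds there,
while the shift h = 2q carries twice the Hardy–Littlewood mass — so the uniform Green–Tao conjecture
is refuted in the
illusory world (tree: `PairsToGHL.Negative.not_generalizedHardyLittlewood_of_unboundedSiegelZeros`,
mod the vendored
MatomakiMerikoski2023 Thm 1.3). This route factors GHL EXACTLY along that mechanism: GHL ⟺ Q ∧ U♮ ∧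
L♮ (draft file
theorem `ghl_iff_pieces`), with every piece absolute and strictly weaker — Q is blind to twin
primes, U♮ and L♮ are silent
exactly where the illusory world bites (`witness_scale_exceptional`), so a proof of U♮ → GHL would
be a Landau–Siegel
theorem from a window-blind hypothesis. What it does that prior routes do not: every existing GHL
decomposition ends in an
implication-shaped residual (stmt-Parity-18380 TwinLowerDensityToGHL, stmt-Parity-9389 PairsToGHL)
or an EQUIV (DimOne);
here there is no `X → GHL` item, the Landau–Siegel content is a separate leaf with live rung routes
(PrimeLevelFamEdge,
ZDegreeToeplitzBand: Zhang2022LandauSiegel Thm 1 discretised), and the parity-hard content is split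
by sign (upper: sieve
ladder 4 → 3.5 → 3.29956 → 2 = EH, BombieriDavenport1966 / Lichtman2025LinearSieve; lower:
TwinLowerDensity cluster).
Imported area: analytic theory of real characters (Deuring–Heilbronn phenomenon) as the normal-form
generator.

RANKED CRUXES. #2 SiegelFreeNoDeficit (crux) — NO DEFICIT AT SIEGEL-FREE SCALES — for all η₀, q₀, d,
t, L ≥ 1, ε > 0, for all large N not in any window q ≤ N ≤ q^η of a Siegel zero (quality η ≥ η₀,
conductor q ≥ q₀), uniformly over non-degenerate Ψ with ‖Ψ‖_N ≤ L and convex K ⊆ [−N,N]^d: β_∞ Π_p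
β_p − Σ_{K∩ℤ^d} Π Λ(ψ_i n) ≤ ε N^d. Declared residual (contains twin primes at Siegel-free scales).
[difficulty: open-problem] (why it might fail: it cannot fail if GHL holds (GHL ⟹ L♮
kernel-trivial); open-problem: it contains π₂(x) ≫ x/log²x at Siegel-free scales and no lower bound
for any prime pair is known (parity: SelbergParity, FordMaynardPrimeSieves).) [GreenTao2010,
TaoTeravainen2021, MatomakiMerikoski2023, HeathBrown1983PrimeTwins]
#3 NoUnboundedSiegelZeros (crux) — Siegel zeros have BOUNDED quality at large conductors: there are
η₀, q₀ such that no primitive quadratic character of conductor q ≥ q₀ has L(1 − 1/(η log q), χ) = 0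
with η ≥ η₀ — the negation, verbatim, of the tree's registered open statement `UnboundedSiegelZeros`
(Tao–Teräväinen Def. 1.4). Necessary for GHL (mod MM2023 Thm 1.3, tree theorem); same leaf as writer
frame GA's Q. [difficulty: open-problem] (why it might fail: it is an effective Landau–Siegel
statement (weaker than rh.S34 NoSiegelZeros, `not_unboundedSiegelZeros_of_noSiegelZeros`): open
since 1935; only Siegel's ineffective η ≪_ε q^ε and Zhang's announced (log D)^{-2022} programme bear
on it.) [TaoTeravainen2021, MatomakiMerikoski2023, Zhang2022LandauSiegel, GoldstonSuriajaya2021]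
#4 SiegelFreeNoExcess (crux) — NO EXCESS AT SIEGEL-FREE SCALES — same quantifier block as
SiegelFreeNoDeficit with the upper inequality Σ_{K∩ℤ^d} Π Λ(ψ_i n) − β_∞ Π_p β_p ≤ ε N^d. Attack
conjunct of the parity side: upper-bound sieves give the unrestricted statement with 1+ε replaced by
4 (PROVED, `TwinSieveFour.twinSieveUpperBound_four`), 3.5 (BFI), 3.29956 (Lichtman), 2 under EH.
[difficulty: open-problem] (why it might fail: cannot fail if GHL holds; as a target it sits below
the sieve parity ceiling C = 2 (SelbergParity, LinearSieveOptimality) and, uniformly in shifts h ≤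
LN, even C < 2 forces Siegel-zero repulsion (GoldstonSuriajaya2021 Thm 1) — consistent here only
because windows are excised.) [GreenTao2010, BombieriDavenport1966, Lichtman2025LinearSieve,
GoldstonSuriajaya2021, MatomakiMerikoski2023]

TWO-LAYER PLAN. Foreseen (not filed): L♮ ⇐ its weakest named rung T = TwinLowerDensity
(stmt-Parity-18377) with the recorded child split
T ⟸ PositiveProportionBoundedGaps ∧ TwinShare (draft theorem `twinLowerDensity_of_ppbg_twinShare`;
both T-implied, neither
known to give T). U♮ ⇐ the unrestricted constant ladder TwinSieveUpperBound C (4 proved, 2 = EH) as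
rungs, never as a split
(C > 1 statements do not glue to C = 1).

KILL CRITERIA. A refutation of Q (a proof of UnboundedSiegelZeros) refutes GHL itself (tree bridge)
— the summit conjunct dies, not just the
route. A refutation of U♮ or L♮ at a Siegel-free scale refutes GHL likewise. The route is mooted
(superseded) if the writer's
frame GA «OneSidedHalves» is born with the same Q and absolute Siegel-free halves; it pivots to 2
binders (Q, two-sided
SiegelFreeGHL) if the critic rules the sign split decorative.

NOT DECOMPOSED YET. The windows' shape (q ≤ N ≤ q^η) is deliberately generous (Matomäki–Merikoski
need V ≥ 10 and are informative for V ≤ η/log⁷η);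
no attempt to shrink them. The `3 ∣ q`, h = 2q/3 total-deficit computation (MM correction factor 0)
showing the illusory world
threatens the lower half too is recorded in the draft docstring, not typed. The d = 1 reduction
(DicksonFibration, EQUIV) is not
stacked on top. Constants of the upper ladder are rungs, not items.

CHEAPEST FALSIFIER. Kernel probe `example : SiegelFreeNoExcess → GeneralizedHardyLittlewood := by
exact?/aesop` must FAIL (else U♮ is the summit
reworded) — it fails (no theorem handles the windows); and `ledger negatives --problem Parity` (5
items: 20012, 18416, 9541,
14832, 4218) contains no one-sided or Siegel-localised GHL statement. Cheapest mathematical kill: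
exhibit a printed theorem
deriving twin-prime-type LOWER bounds from bounded Siegel quality (none exists:
Friedlander–Iwaniec/Heath-Brown go the other way).

NUMBERS. Upper ladder for π₂(x)/(2C₂x/log²x): 4 (Bombieri–Davenport 1966; tree
`twinSieveUpperBound_four`), 3.5 (Bombieri–Friedlander–Iwaniec
1986), 3.418 (Wu 1990), 3.3996 (Wu 2004), 3.29956 (Lichtman2025LinearSieve Thm 1.2), 2 under EH
(`twinSieveUpperBound_two_of_EH`), parity
floor 2 for Type-I sieves. Siegel quality: η ≪_ε q^ε (Siegel, ineffective); MM2023 Thm 1.3 range X =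
q^V, V ≥ 10, error V log⁶η/η.

DEFINITION REQUESTS. None (the window predicate is inlined;
`Literature.Barriers.Parity.IsSiegelZero` exists).

Novelty: Searches (2026-08-30): lit search --hybrid "Hardy-Littlewood conjecture exceptional Siegel zero
prime pairs asymptotic" (6 textbook hits: [corpus:book:montgomery2007 p.282,300],
[corpus:book:cojocaru2005 p.102]); lit search "Heath-Brown Siegel zeros twin primes" --source local
(hits [corpus:paper:arxiv-2112.11412 p.2-3] = MatomakiMerikoski2023, [corpus:paper:arxiv-2109.06291
p.2] = TaoTeravainen2021, [corpus:paper:doi-10-4064-aa96-2-3 p.5]); lit vsearch "<decomposition of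
twin primes into Siegel case and non-exceptional case>" (6 textbook hits, none on a decomposition);
lit galaxy search "Siegel zeros" --star pdf ([galaxy:pdf:3333917200] Granville survey;
[galaxy:pdf:-5594296035565099900] Drappeau–Fiorilli); tree: rg UnboundedSiegelZeros
(SiegelZeroDichotomy*, PairsToGHL/Negative, DimOnePosition), HOME/TREE.md GA, critic T6.
Nearest prior art found: HeathBrown1983PrimeTwins / TaoTeravainen2021 Thm 1.5 /
MatomakiMerikoski2023 Thm 1.3 (the dichotomy technique: prove HL-type statements in the illusory
branch); in-tree `Literature.Barriers.Parity.SiegelZeroTwinPrimes` and the critic's T6 collapse S ⟺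
Q ∧ (Q → S); writer frame GA (sign split with Q → Upper residual).
Delta: the dichotomy is used here not to prove a consequence in one branch but to FACTOR the summit
conjunct exactly into an effective Landau–Siegel leaf and an absolute, scale-localised, signed
Hardy–Littlewood statement that is silent inside exceptional windows — replacing every
implication-shaped residual on this s  [refs: book:montgomery2007, book:cojocaru2005, paper:arxiv-2112.11412, paper:arxiv-2109.06291, paper:doi-10-4064-aa96-2-3, MatomakiMerikoski2023, TaoTeravainen2021]

Barriers (technique_class: siegel-zero-dichotomy, one-sided-bounds, decomposition): - technique_class: siegel-zero-dichotomy, one-sided-bounds, decomposition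
- Literature.Barriers.Parity.SiegelZeroTwinPrimes: it is ABOUT Q (a disproof of twin primes /
GHL-type statements bounds Siegel zeros, HeathBrown1983PrimeTwins, MatomakiMerikoski2023); the route
places that content in the leaf NoUnboundedSiegelZeros and excises the exceptional windows from
SiegelFreeNoExcess / SiegelFreeNoDeficit — outside the barrier's scope by construction.
- Literature.Barriers.Parity.SiegelZeroPrimePairBarrier: GoldstonSuriajaya2021 — a shift-uniform
pair upper bound with constant < 2 implies zero repulsion; SiegelFreeNoExcess asserts constant 1
only at Siegel-free scales, so closing it does not by itself bound Siegel zeros; the bet is that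
this is exactly the split that makes the upper half Siegel-consistent.
- Literature.Barriers.Parity.BrunTitchmarshSiegelZero: consistent — the uniform Brun–Titchmarsh C <
2 content lives in the leaf NoUnboundedSiegelZeros, not in the Siegel-free halves.
- Literature.Barriers.Parity.SelbergParityBarrier: it DOES apply to SiegelFreeNoExcess below sieve
constant 2 and to SiegelFreeNoDeficit outright (Type-I deductions give no pair lower bound); not
evaded — the upper half is instrumentable down to C = 2 and idea-needed below, the lower half is the
declared residual.
- Literature.Barriers.Parity.LinearSieveOptimality: same placement — the upper ladder 4 → 3.5 →
3.29956 → 2 is a rung ladder capped at 2 by sifting-limit optimality; the cap-lift (biline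

History (route lifecycle, newest last):
- 2026-08-30T02:01:27Z · rev 1: restated NoUnboundedSiegelZeros (stmt-Parity-24711) — conjecture migration: UnboundedSiegelZeros is now Summit.Parity.GeneralizedHardyLittlewood.UnboundedSiegelZeros (gate:conjectures)
- 2026-09-04T15:05:02Z · DORMANT — reconciler: no traction for 5 d (last activity statement-checked at 2026-08-30T13:52:06Z); parked, not closed — `ledger route dormant route-Parity-ExceptionalWi (operator:999:2039290)

sub-problem: GeneralizedHardyLittlewood · status: dormant · opened planner-decomp-parity-lens-4-g0-0 2026-08-30T02:00:11Z · rev 0 · ledger route-Parity-ExceptionalWindows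
GENERATED by the gate from the ledger (D-0016/17). Provers cite these decls: `theorem foo : Summit.Parity.GeneralizedHardyLittlewood.Theses.ExceptionalWindows.<Decl> := …` in Summits/Parity/GeneralizedHardyLittlewood/Theorems/<Name>.lean.
-/

namespace Summit.Parity.GeneralizedHardyLittlewood.Theses.ExceptionalWindows

open scoped BigOperators Topology Manifold Classical MeasureTheory ProbabilityTheory Matrix InnerProductSpace ComplexConjugate ContinuousMap
open Filter Set Function TopologicalSpace MeasureTheory

attribute [summit_statement] _root_.GeneralizedHardyLittlewood

/-- item stmt-Parity-24710 · crux · rank 2 · open · by planner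
why it might fail: it cannot fail if GHL holds (GHL ⟹ L♮ kernel-trivial); open-problem: it contains π₂(x) ≫ x/log²x at Siegel-free scales and no lower bound for any prime pair is known (parity: SelbergParity, FordMaynardPrimeSieves).
sources: GreenTao2010, TaoTeravainen2021, MatomakiMerikoski2023, HeathBrown1983PrimeTwins
[crux] NO DEFICIT AT SIEGEL-FREE SCALES — for all η₀, q₀, d, t, L ≥ 1, ε > 0, for all large N not in
any window q ≤ N ≤ q^η of a Siegel zero (quality η ≥ η₀, conductor q ≥ q₀), uniformly over
non-degenerate Ψ with ‖Ψ‖_N ≤ L and convex K ⊆ [−N,N]^d: β_∞ Π_p β_p − Σ_{K∩ℤ^d} Π Λ(ψ_i n) ≤ ε N^d.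
Declared residual (contains twin primes at Siegel-free scales). [difficulty: open-problem] -/
@[route_item "route-Parity-ExceptionalWindows"]
def SiegelFreeNoDeficit : Prop :=
  ∀ (η₀ : ℝ) (q₀ : ℕ) (d t L : ℕ), 1 ≤ d → 1 ≤ t → ∀ ε : ℝ, 0 < ε → ∃ N₀ : ℕ, ∀ N : ℕ, N₀ ≤ N → (¬ ∃ (q : ℕ) (_ : NeZero q) (χ : DirichletCharacter ℂ q) (η : ℝ), q₀ ≤ q ∧ η₀ ≤ η ∧ Literature.Barriers.Parity.IsSiegelZero χ η ∧ (q : ℝ) ≤ (N : ℝ) ∧ (N : ℝ) ≤ (q : ℝ) ^ η) → ∀ Ψ : Fin t → Literature.NumberTheory.Sieve.AffLinForm d, Literature.NumberTheory.Sieve.IsNondegenerateSystem Ψ → Literature.NumberTheory.Sieve.affLinSize Ψ N ≤ L → ∀ K : Set (Fin d → ℝ), Convex ℝ K → K ⊆ Literature.NumberTheory.Sieve.realBox d N → Literature.NumberTheory.Sieve.archFactor Ψ K * Literature.NumberTheory.Sieve.singularProduct Ψ - Literature.NumberTheory.Sieve.vonMangoldtSum Ψ K N ≤ ε * (N : ℝ)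 ^ d

/-- item stmt-Parity-24711 · crux · rank 3 · open · by planner
why it might fail: it is an effective Landau–Siegel statement (weaker than rh.S34 NoSiegelZeros, `not_unboundedSiegelZeros_of_noSiegelZeros`): open since 1935; only Siegel's ineffective η ≪_ε q^ε and Zhang's announced (log D)^{-2022} programme bear on it.
sources: TaoTeravainen2021, MatomakiMerikoski2023, Zhang2022LandauSiegel, GoldstonSuriajaya2021
[crux] Siegel zeros have BOUNDED quality at large conductors: there are η₀, q₀ such that no
primitive quadratic character of conductor q ≥ q₀ has L(1 − 1/(η log q), χ) = 0 with η ≥ η₀ — the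
negation, verbatim, of the tree's registered open statement `UnboundedSiegelZeros` (Tao–Teräväinen
Def. 1.4). Necessary for GHL (mod MM2023 Thm 1.3, tree theorem); same leaf as writer frame GA's Q.
[difficulty: open-problem] -/
@[route_item "route-Parity-ExceptionalWindows"]
def NoUnboundedSiegelZeros : Prop :=
  ¬ Literature.Barriers.Parity.UnboundedSiegelZeros

/-- item stmt-Parity-24712 · crux · rank 4 · open · by planner
why it might fail: cannot fail if GHL holds; as a target it sits below the sieve parity ceiling C = 2 (SelbergParity, LinearSieveOptimality) and, uniformly in shifts h ≤ LN, even C < 2 forces Siegel-zero repulsion (GoldstonSuriajaya2021 Thm 1) — consistent here only because windows are excised.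
sources: GreenTao2010, BombieriDavenport1966, Lichtman2025LinearSieve, GoldstonSuriajaya2021, MatomakiMerikoski2023
[crux] NO EXCESS AT SIEGEL-FREE SCALES — same quantifier block as SiegelFreeNoDeficit with the upper
inequality Σ_{K∩ℤ^d} Π Λ(ψ_i n) − β_∞ Π_p β_p ≤ ε N^d. Attack conjunct of the parity side:
upper-bound sieves give the unrestricted statement with 1+ε replaced by 4 (PROVED,
`TwinSieveFour.twinSieveUpperBound_four`), 3.5 (BFI), 3.29956 (Lichtman), 2 under EH. [difficulty:
open-problem] -/
@[route_item "route-Parity-ExceptionalWindows"]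
def SiegelFreeNoExcess : Prop :=
  ∀ (η₀ : ℝ) (q₀ : ℕ) (d t L : ℕ), 1 ≤ d → 1 ≤ t → ∀ ε : ℝ, 0 < ε → ∃ N₀ : ℕ, ∀ N : ℕ, N₀ ≤ N → (¬ ∃ (q : ℕ) (_ : NeZero q) (χ : DirichletCharacter ℂ q) (η : ℝ), q₀ ≤ q ∧ η₀ ≤ η ∧ Literature.Barriers.Parity.IsSiegelZero χ η ∧ (q : ℝ) ≤ (N : ℝ) ∧ (N : ℝ) ≤ (q : ℝ) ^ η) → ∀ Ψ : Fin t → Literature.NumberTheory.Sieve.AffLinForm d, Literature.NumberTheory.Sieve.IsNondegenerateSystem Ψ → Literature.NumberTheory.Sieve.affLinSize Ψ N ≤ L → ∀ K : Set (Fin d → ℝ), Convex ℝ K → K ⊆ Literature.NumberTheory.Sieve.realBox d N → Literature.NumberTheory.Sieve.vonMangoldtSum Ψ K N - Literature.NumberTheory.Sieve.archFactor Ψ K * Literature.NumberTheory.Sieve.singularProduct Ψ ≤ ε * (N : ℝ) ^ d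

/-- item stmt-Parity-24713 · assembly · rank 1 · closed · proved by Summit.Parity.GeneralizedHardyLittlewood.Theses.ExceptionalWindows.assembly_proof (prover) · by planner
sources: GreenTao2010, MatomakiMerikoski2023
[assembly] NoUnboundedSiegelZeros → SiegelFreeNoExcess → SiegelFreeNoDeficit →
GeneralizedHardyLittlewood -/
@[route_item "route-Parity-ExceptionalWindows"]
def Assembly : Prop :=
  NoUnboundedSiegelZeros → SiegelFreeNoExcess → SiegelFreeNoDeficit → GeneralizedHardyLittlewood

-- `Assembly` holds: proved by `Summit.Parity.GeneralizedHardyLittlewood.Theses.ExceptionalWindows.assembly_proof` (its module imports this route file, so no `_holds` link can be stated here).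

/-! D-0027 §2.1 — DECIDING THEOREM (planner-authored via `route open/edit --closes-file`; by planner-decomp-parity-lens-4-g0-0 2026-08-30T02:00:11Z):
its hypotheses are this route's items and its conclusion the sub-problem Statement (glue_lint), and it elaborates with this file. -/

@[closes "route-Parity-ExceptionalWindows"] theorem closes (hQ : NoUnboundedSiegelZeros) (hU : SiegelFreeNoExcess) (hL : SiegelFreeNoDeficit) :
    GeneralizedHardyLittlewood := by
  have hA : Assembly := by
    intro hQ' hU' hL'
    classical
    have hQ0 : ¬ Literature.Barriers.Parity.UnboundedSiegelZeros := hQ'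
    unfold Literature.Barriers.Parity.UnboundedSiegelZeros at hQ0
    push Not at hQ0
    obtain ⟨η₀, q₀, hno⟩ := hQ0
    intro d t L hd ht ε hε
    obtain ⟨N₁, hN₁⟩ := hU' η₀ q₀ d t L hd ht ε hε
    obtain ⟨N₂, hN₂⟩ := hL' η₀ q₀ d t L hd ht ε hε
    refine ⟨max N₁ N₂, fun N hN Ψ hΨ hsz K hK hKN => ?_⟩
    have hfree : ¬ ∃ (q : ℕ) (_ : NeZero q) (χ : DirichletCharacter ℂ q) (η : ℝ),
        q₀ ≤ q ∧ η₀ ≤ η ∧ Literature.Barriers.Parity.IsSiegelZero χ η ∧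
          (q : ℝ) ≤ (N : ℝ) ∧ (N : ℝ) ≤ (q : ℝ) ^ η := by
      rintro ⟨q, hq0, χ, η, hq, hη, hS, -, -⟩
      exact hno q hq0 χ η hq hη hS
    have h1 := hN₁ N (le_of_max_le_left hN) hfree Ψ hΨ hsz K hK hKN
    have h2 := hN₂ N (le_of_max_le_right hN) hfree Ψ hΨ hsz K hK hKN
    rw [abs_le]
    constructor <;> linarith
  exact hA hQ hU hL

end Summit.Parity.GeneralizedHardyLittlewood.Theses.ExceptionalWindows
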